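import Mathlib
import HarnessLib
import Summits.HubbardSuperconductivity.HubbardSuperconductivity.Theorems.KLProgrammeKLRegimeEngineTowerLevReadoutFit
import Summits.HubbardSuperconductivity.HubbardSuperconductivity.Theorems.KLProgrammeKLRegimeEngineTowerLevReadoutProfileFAnyJump

/-!
# Route `KLProgramme` — crux K3 ENGINE (stmt-HubbardSuperconductivity-20437 `KLRegimeEngineV17F2`), stub (b) v2, THE LEVELS PACKAGE (ℓ), located item
# «(ℓ)-READOUT-F» piece RO-4 (model half): THE LEVELLED NORM OF `𝒱_j` AT ITS OWN FAMILY `F_j`, `j ∈ [dk, d(k+1))`, IS BELOW `KernelNormsLevels`' RIGHT-HAND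
# SIDE — from the law's bounds on the blocks `≤ k`, the EXPORTED Chernoff data of block `k`, the base datum, and the partial-block step (RO-2) AS NAMED INPUTS
# (cell gate-hubbard-kl, seat hubbard-kl-k3c3-p2 g16; …TowerLevReadoutProfileF (RO-1) ∘ …TowerLevReadoutFit (RO-4 generic))

WHY.  Stub (b)'s conjunct `KernelNormsLevels … (K_n) j` reads `klAnisoLegKernelNormAt … j (2p) Ωe = klLevNormOf … j (2p) 𝒱_j Ωe` (`klLevNormOf_klEffectiveAction`).
With `dk ≤ j`, `𝒱_j = 𝒱_{dk} + (𝒱_j − 𝒱_{dk})`; the first summand is re-measured at `F_j` by RO-1 (`readoutLevF_le_profileR`: the law's input profile verbatim), the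
second is the partial-block increment, which obeys the kit step read on the block's scaled measured array `W·Z^m·klTowerMuLevF … d k m` (k3c2-p3's RO-2, here the
named input `hinc`), whose Chernoff data and smallness rows are exactly what the export twins `…_tokX` of the law return.  E1's part 7 (`towerReadout_le_of_ro`)
sums the two under one law `A_tot·λ^{p−1}·Q_tot^p`, and the floor units row turns that into the registered right-hand side.

* **`readoutLevF_le_levelsRHS_of_rows`** — `∃ C₁ C₂ > 0` (RO-1's constants) and thresholds, such that under the stub binders, for `2 ≤ d`, `1 ≤ k`, `dk ≤ j`,
  `2d − 2 ≤ j ≤ n_β + 1`, `3 ≤ D`, at `λ = B·ε_j` (`B ≥ 1`): GIVEN the base datum `N_b` with its unit law `(A_b, Q_b)`, the law `klTowerBLevF … d t k′ p ≤ Aλ^{p−1}Q^p`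
  on the blocks `2 ≤ k′ ≤ k`, the Chernoff data of block `k` (`W·Z^m·klTowerMuLevF d k m ≤ A′λ^{m−1}Q′^m`, `4 ≤ m ≤ D`; `W·Z³·… ≤ ι₃λ²`; imports `ι₁λ`, `ι₂λ`), the five
  smallness rows at `(A′, Q′, λ)`, and the partial-block step `hinc` at `(k, j)` for every track, then for every track `t`, `3 ≤ p ≤ D` with `2p + t ≥ 7` and every
  prescription `Ωe` of level `t + 1` at `F_j`:
  `klLevNormOf … j (2p) 𝒱_j Ωe ≤ CE^p·ε_j^{p−1}·2^{(3p−5)j}·((2^j)⁻¹)^{levelGainExp (t+1)}` as soon as `CE ≥ (Q_tot·ε_x²)·B·max 1 (A_tot/ε_x)` with the EXPLICIT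
  `Q_tot = max 1 (max Q_ro (max (4Q′) (2τψQ′)))`, `A_tot = A_ro + A′·x₁/(1−x₁) + e·ψ·(τY)·(ΦτY/(1−ΦτY))`, `A_ro = 27⁵(C₁/C₂)8^{d−1}(A_b + A/(1−(2^d)⁻¹))`,
  `Q_ro = C₂²(2^{d−1})⁻¹·max Q Q_b` (equational binders).
What is NOT covered here (RO-5's, by design): the levels `j < d` (block 0, RO-3), the level counts `F = 0` and `F ≥ 6` (monotonicity in the prescription), the
corner `(p, t) = (3, 0)` (the read-out six-leg cell), the degree cap `p > D` (p4's «(ℓ)-RO5-DEGREE-CAP»), and the choice of ONE `CE` over all `j` (majorise `A_tot(λ)`).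
Compositions of landed theorems and real algebra; nothing about the model is asserted beyond them; nothing asserts (ℓ), any stub, K3 or superconductivity.
References: BGM 2006 §2.8 (2.83), (2.93)–(2.98), Lemma 2.5 (2.98) [cite: BenfattoGiulianiMastropietro2006].
-/

noncomputable section

namespace Summit.HubbardSuperconductivity.HubbardSuperconductivity.Theorems.EngineV8

set_option linter.dupNamespace false -- summit = problem name (single-conjunct summit), D-0017

open Classical
open Real Finset Literature.MathematicalPhysics.QuantumLattice Literature.Probability.LatticeModels GrassmannAlgebra
open Literature.MathematicalPhysics.QuantumLattice.FermiRG
open Summit.HubbardSuperconductivity.HubbardSuperconductivity.Theorems.KLProgrammeLegKernels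
open Summit.HubbardSuperconductivity.HubbardSuperconductivity.Theorems.KLRegimeSplit
open Summit.HubbardSuperconductivity.HubbardSuperconductivity.Theorems.KLRegimeWick
open Summit.HubbardSuperconductivity.HubbardSuperconductivity.Theorems.TorusFourierL2
open Summit.HubbardSuperconductivity.HubbardSuperconductivity.Theorems.DispersionFlow
open Summit.HubbardSuperconductivity.HubbardSuperconductivity.Theorems.PerturbedFermiCurve

variable {L M : ℕ} [NeZero L] [NeZero M]

omit [NeZero L] [NeZero M] in
/-- **THE READ-OUT AT LEVEL `j ∈ [dk, d(k+1))` IS BELOW `KernelNormsLevels`' RIGHT-HAND SIDE, FROM NAMED INPUTS** (see the module docstring for the inputs and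
for what is left to RO-5). [cite: BenfattoGiulianiMastropietro2006, §2.8 (2.83), (2.93)-(2.98), Lemma 2.5 (2.98)] -/
theorem readoutLevF_le_levelsRHS_of_rows :
    ∃ C₁ C₂ : ℝ, 0 < C₁ ∧ 0 < C₂ ∧ ∀ R : RenConsts, R.WF2 → ∃ c₃' : ℝ, 0 < c₃' ∧ ∃ U₀' : ℝ, 0 < U₀' ∧
      ∀ (P : SplitConsts) (c : ℝ), P.WF → 0 < c → c ≤ klEngC₃6 P R → c ≤ c₃' →
      ∀ μ ∈ klWindowC, ∀ U : ℝ, 0 < U → U ≤ klEngU₀9 P R c → U ≤ U₀' → ∀ β : ℝ, klBetaMin ≤ β → β ≤ Real.exp (c / U ^ 2) →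
      ∀ K : TrigPolyC4v, FrameOK R U (nScales β) μ K → ∀ (L M : ℕ) [NeZero L] [NeZero M],
      klEngL₃ β U ≤ L → klEngM₃ β U L ≤ M → ∀ d k j D : ℕ, 2 ≤ d → 1 ≤ k → d * k ≤ j → 2 * d - 2 ≤ j → j ≤ nScales β + 1 → 3 ≤ D →
      ∀ (A B Q Ab Qb : ℝ), 0 ≤ A → 1 ≤ B → 0 ≤ Q → 0 ≤ Ab → 0 ≤ Qb →
      -- the base datum at `F_{d−1}` and its unit law, at `λ = B·ε_j`
      ∀ Nb : Fin 5 → ℕ → ℝ, (∀ t p, 0 ≤ Nb t p) →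
        (∀ (t : Fin 5) (p : ℕ) (Ωe' : Fin (2 * p) → Option (SectorLeg (sectorCount (d - 1)))), levelCount Ωe' = (t : ℕ) + 1 →
          klLevNormOf L M β μ K (d - 1) (2 * p) (klTowerInput L M β U μ K d 1) Ωe' ≤ Nb t p) →
        (∀ (t : Fin 5) (p : ℕ), 3 ≤ p → Nb t p / klLevUnitF β M t p (d - 1) ≤ Ab * (B * epsCoupling P U j) ^ (p - 1) * Qb ^ p) →
      -- the law on the blocks `2 ≤ k′ ≤ k`
      (∀ k' : ℕ, 2 ≤ k' → k' ≤ k → ∀ (t : Fin 5) (p : ℕ), 3 ≤ p → p ≤ D →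
        klTowerBLevF L M β U μ K d t k' p ≤ A * (B * epsCoupling P U j) ^ (p - 1) * Q ^ p) →
      ∀ (W Z σ Φ ψ τ A' Q' ι₁ ι₂ ι₃ : ℝ), 0 < W → 0 < Z → 0 ≤ σ → 0 ≤ Φ → 0 ≤ ψ → 0 < τ → 0 ≤ A' → 0 < Q' →
      -- the Chernoff data of block `k` (exported by the law) and the imports at block `k`
      (∀ m, 4 ≤ m → m ≤ D → W * Z ^ m * klTowerMuLevF L M β U μ K d k m ≤ A' * (B * epsCoupling P U j) ^ (m - 1) * Q' ^ m) →
      W * Z ^ 3 * klTowerMuLevF L M β U μ K d k 3 ≤ ι₃ * (B * epsCoupling P U j) ^ 2 →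
      W * Z ^ 1 * klTowerMuLevF L M β U μ K d k 1 ≤ ι₁ * (B * epsCoupling P U j) →
      W * Z ^ 2 * klTowerMuLevF L M β U μ K d k 2 ≤ ι₂ * (B * epsCoupling P U j) →
      -- the five smallness rows at `(A′, Q′, λ)` (exported by the law)
      4 * σ * (B * epsCoupling P U j) * Q' < 1 → 2 * (B * epsCoupling P U j) * τ * Q' ≤ 1 → exp 1 * τ * (B * epsCoupling P U j) * Q' < 1 →
      Φ * (τ * (ι₁ * (B * epsCoupling P U j) + ι₂ / (2 * Q') + ι₃ / (4 * Q' ^ 2) + A' * Q' / 4)) < 1 →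
      Φ * (exp 1 * τ * (ι₁ * (B * epsCoupling P U j)) + (exp 1 * τ) ^ 2 * (ι₂ * (B * epsCoupling P U j)) +
          (exp 1 * τ) ^ 3 * (ι₃ * (B * epsCoupling P U j) ^ 2) +
        A' * (exp 1 * τ * Q') * ((exp 1 * τ * (B * epsCoupling P U j) * Q') ^ 3 / (1 - exp 1 * τ * (B * epsCoupling P U j) * Q'))) < 1 →
      -- the partial-block step at `(k, j)`, every track (k3c2-p3's RO-2)
      (∀ t : Fin 5, ∀ N : ℕ, 2 ≤ N → ∀ p, 3 ≤ p → p ≤ D →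
        Φ * towerV D τ (fun m => W * Z ^ m * klTowerMuLevF L M β U μ K d k m) < 1 →
        ∀ Ωe : Fin (2 * p) → Option (SectorLeg (sectorCount j)), levelCount Ωe = (t : ℕ) + 1 →
        klLevNormOf L M β μ K j (2 * p) (klEffectiveAction L M β U μ K klE0 j - klTowerInput L M β U μ K d k) Ωe / klLevUnitF β M t p j ≤
          towerFO D σ (fun m => W * Z ^ m * klTowerMuLevF L M β U μ K d k m) p +
            ∑ n ∈ Icc 2 N, exp 1 * Φ ^ (n - 1) * ψ ^ p * towerS D τ (fun m => W * Z ^ m * klTowerMuLevF L M β U μ K d k m) n p +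
            ψ ^ p * exp 1 * towerV D τ (fun m => W * Z ^ m * klTowerMuLevF L M β U μ K d k m) *
              (Φ * towerV D τ (fun m => W * Z ^ m * klTowerMuLevF L M β U μ K d k m)) ^ N /
              (1 - Φ * towerV D τ (fun m => W * Z ^ m * klTowerMuLevF L M β U μ K d k m))) →
      -- the read-out constants (equational binders) and the threshold
      ∀ (Aro Qro Qtot Atot : ℝ), Aro = (27 : ℝ) ^ 5 * (C₁ / C₂) * (8 : ℝ) ^ (d - 1) * (Ab + A / (1 - ((2 : ℝ) ^ d)⁻¹)) →
        Qro = C₂ ^ 2 * ((2 : ℝ) ^ (d - 1))⁻¹ * max Q Qb → Qtot = max 1 (max Qro (max (4 * Q') (2 * τ * ψ * Q'))) →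
        Atot = Aro + A' * (4 * σ * (B * epsCoupling P U j) * Q' / (1 - 4 * σ * (B * epsCoupling P U j) * Q')) +
          exp 1 * ψ * (τ * (ι₁ * (B * epsCoupling P U j) + ι₂ / (2 * Q') + ι₃ / (4 * Q' ^ 2) + A' * Q' / 4)) *
            (Φ * (τ * (ι₁ * (B * epsCoupling P U j) + ι₂ / (2 * Q') + ι₃ / (4 * Q' ^ 2) + A' * Q' / 4)) /
              (1 - Φ * (τ * (ι₁ * (B * epsCoupling P U j) + ι₂ / (2 * Q') + ι₃ / (4 * Q' ^ 2) + A' * Q' / 4)))) →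
      ∀ CE : ℝ, Qtot * imagTimeWeight β M ^ 2 * B * max 1 (Atot / imagTimeWeight β M) ≤ CE →
      ∀ (t : Fin 5) (p : ℕ), 3 ≤ p → p ≤ D → 7 ≤ 2 * p + (t : ℕ) →
      ∀ Ωe : Fin (2 * p) → Option (SectorLeg (sectorCount j)), levelCount Ωe = (t : ℕ) + 1 →
        klLevNormOf L M β μ K j (2 * p) (klEffectiveAction L M β U μ K klE0 j) Ωe ≤
          CE ^ p * epsCoupling P U j ^ (p - 1) * (2 : ℝ) ^ ((3 * (p : ℤ) - 5) * j) * (((2 : ℝ) ^ j)⁻¹) ^ levelGainExp ((t : ℕ) + 1) := by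
  obtain ⟨C₁, C₂, hC₁, hC₂, h⟩ := readoutLevF_le_profileR
  refine ⟨C₁, C₂, hC₁, hC₂, fun R hR2 => ?_⟩
  obtain ⟨c₃, hc₃, U₀, hU₀, h'⟩ := h R hR2
  refine ⟨c₃, hc₃, U₀, hU₀, ?_⟩
  intro P c hP hc hc6 hc₃' μ hμ U hU hU9 hU₀' β hβmin hβc K hK L M _ _ hL3 hM3 d k j D hd hk1 hkj h2d hjN hD A B Q Ab Qb hA hB hQ hAb hQb Nb hNb0 hcar
    hlawb hIH W Z σ Φ ψ τ A' Q' ι₁ ι₂ ι₃ hW hZ hσ hΦ hψ hτ hA'0 hQ'0 hprof hprof3 himp₁ himp₂ hx₁ hx₂ hx₃ hy hθ hinc Aro Qro Qtot Atot hAro hQro hQtot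
    hAtot CE hCE t p hp hpD hpt Ωe hlev
  have hβ : 0 < β := KLRegimeSplit.pos_of_klBetaMin_le hβmin
  have hK1 : 1 ≤ P.Klam := hP.1
  have hKl : 0 ≤ P.Klam := le_trans zero_le_one hK1
  have hε : 0 < epsCoupling P U j := by
    unfold epsCoupling
    have : 0 < |U| + U ^ 2 * (j : ℝ) := by positivity
    positivity
  have hB0 : 0 < B := lt_of_lt_of_le one_pos hB
  set lam : ℝ := B * epsCoupling P U j with hlamdef
  have hlam : 0 < lam := mul_pos hB0 hε
  have hu : 0 < klLevUnitF β M t p j := klLevUnitF_pos hβ t p j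
  have hμ0 : ∀ m, 0 ≤ (fun m => W * Z ^ m * klTowerMuLevF L M β U μ K d k m) m := fun m =>
    mul_nonneg (by positivity) (klTowerMuLevF_nonneg (L := L) (M := M) hβ U μ K d k m)
  -- the nonnegativity of the imports from the rows
  have hι₁0 : 0 ≤ ι₁ := by
    have h1 : 0 ≤ ι₁ * lam := (hμ0 1).trans himp₁
    rw [mul_comm] at h1
    exact nonneg_of_mul_nonneg_right h1 hlam
  have hι₂0 : 0 ≤ ι₂ := by
    have h1 : 0 ≤ ι₂ * lam := (hμ0 2).trans himp₂
    rw [mul_comm] at h1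
    exact nonneg_of_mul_nonneg_right h1 hlam
  have hι₃0 : 0 ≤ ι₃ := by
    have h1 : 0 ≤ ι₃ * lam ^ 2 := (hμ0 3).trans hprof3
    rw [mul_comm] at h1
    exact nonneg_of_mul_nonneg_right h1 (by positivity)
  -- (1) the re-measured part (RO-1), with the weight `27^{t+1} ≥ 1` dropped
  have hX₀0 : 0 ≤ klLevNormOf L M β μ K j (2 * p) (klTowerInput L M β U μ K d k) Ωe := klLevNormOf_nonneg hβ.le μ K j (2 * p) _ Ωe
  have hro27 := h' P c hP hc hc6 hc₃' μ hμ U hU hU9 hU₀' β hβmin hβc K hK L M hL3 hM3 d k j hd hk1 hkj h2d hjN D A lam Q Ab Qb hA hlam.le hQ hAb hQb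
    Nb hNb0 hcar hlawb hIH t p hp hpD hpt Ωe hlev
  have hAro0 : 0 ≤ Aro := by
    have hρ1 : ((2 : ℝ) ^ d)⁻¹ < 1 := inv_lt_one_of_one_lt₀ (one_lt_pow₀ (by norm_num) (by omega))
    have : 0 ≤ A / (1 - ((2 : ℝ) ^ d)⁻¹) := div_nonneg hA (sub_nonneg.2 hρ1.le)
    rw [hAro]; positivity
  have hQro0 : 0 ≤ Qro := by
    have : 0 ≤ max Q Qb := le_max_of_le_left hQ
    rw [hQro]; positivity
  have hro : klLevNormOf L M β μ K j (2 * p) (klTowerInput L M β U μ K d k) Ωe / klLevUnitF β M t p j ≤ Aro * lam ^ (p - 1) * Qro ^ p := by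
    have h27 : (1 : ℝ) ≤ (27 : ℝ) ^ ((t : ℕ) + 1) := one_le_pow₀ (by norm_num)
    have hq0 : 0 ≤ klLevNormOf L M β μ K j (2 * p) (klTowerInput L M β U μ K d k) Ωe / klLevUnitF β M t p j := div_nonneg hX₀0 hu.le
    calc klLevNormOf L M β μ K j (2 * p) (klTowerInput L M β U μ K d k) Ωe / klLevUnitF β M t p j
        ≤ (27 : ℝ) ^ ((t : ℕ) + 1) * klLevNormOf L M β μ K j (2 * p) (klTowerInput L M β U μ K d k) Ωe / klLevUnitF β M t p j := by
          rw [mul_div_assoc]; exact le_mul_of_one_le_left hq0 h27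
      _ ≤ _ := by rw [hAro, hQro]; exact hro27
  -- (2) `𝒱_j = 𝒱_{dk} + (𝒱_j − 𝒱_{dk})`: the public size is at most `ro + inc`
  have hpub : klLevNormOf L M β μ K j (2 * p) (klEffectiveAction L M β U μ K klE0 j) Ωe / klLevUnitF β M t p j ≤
      klLevNormOf L M β μ K j (2 * p) (klTowerInput L M β U μ K d k) Ωe / klLevUnitF β M t p j +
        klLevNormOf L M β μ K j (2 * p) (klEffectiveAction L M β U μ K klE0 j - klTowerInput L M β U μ K d k) Ωe / klLevUnitF β M t p j := by
    rw [← add_div]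
    refine div_le_div_of_nonneg_right ?_ hu.le
    have h := klLevNormOf_add_le hβ.le μ K j (2 * p) (klTowerInput L M β U μ K d k)
      (klEffectiveAction L M β U μ K klE0 j - klTowerInput L M β U μ K d k) Ωe
    rwa [add_sub_cancel] at h
  -- (3) E1 part 7 with the re-measured part under its own profile
  have hfit := towerReadout_le_of_ro (D := D) (μ := fun m => W * Z ^ m * klTowerMuLevF L M β U μ K d k m) hσ hΦ hψ hτ hlam hA'0 hQ'0 hμ0
    himp₁ himp₂ hprof3 hprof hx₁ hx₂ hx₃ hy hθ hp hpub hro (fun N hN hg => hinc t N hN p hp hpD hg Ωe hlev)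
  -- (4) the bracket under one law, and the levels right-hand side
  set Yl : ℝ := ι₁ * lam + ι₂ / (2 * Q') + ι₃ / (4 * Q' ^ 2) + A' * Q' / 4 with hYl
  have hYl0 : 0 ≤ Yl := by positivity
  have hTY : 0 ≤ τ * Yl := by positivity
  have hx10 : 0 ≤ 4 * σ * lam * Q' / (1 - 4 * σ * lam * Q') := div_nonneg (by positivity) (sub_nonneg.2 hx₁.le)
  have hYy : 0 ≤ Φ * (τ * Yl) / (1 - Φ * (τ * Yl)) := div_nonneg (by positivity) (sub_nonneg.2 hy.le)
  have hbr := readoutBracket_le_law hAro0 hQro0 hA'0 hQ'0.le hψ hτ.le hx10 hTY hYy p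
  have hfin : klLevNormOf L M β μ K j (2 * p) (klEffectiveAction L M β U μ K klE0 j) Ωe / klLevUnitF β M t p j ≤
      Atot * (B * epsCoupling P U j) ^ (p - 1) * Qtot ^ p := by
    refine hfit.trans ?_
    rw [hAtot, hQtot, hQro]
    rw [hQro] at hbr
    calc lam ^ (p - 1) * (Aro * (C₂ ^ 2 * ((2 : ℝ) ^ (d - 1))⁻¹ * max Q Qb) ^ p +
            A' * (4 * Q') ^ p * (4 * σ * lam * Q' / (1 - 4 * σ * lam * Q')) +
            exp 1 * ψ * (2 * τ * ψ * Q') ^ (p - 1) * (τ * Yl) * (Φ * (τ * Yl) / (1 - Φ * (τ * Yl))))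
        ≤ lam ^ (p - 1) * ((Aro + A' * (4 * σ * lam * Q' / (1 - 4 * σ * lam * Q')) + exp 1 * ψ * (τ * Yl) * (Φ * (τ * Yl) / (1 - Φ * (τ * Yl)))) *
            (max 1 (max (C₂ ^ 2 * ((2 : ℝ) ^ (d - 1))⁻¹ * max Q Qb) (max (4 * Q') (2 * τ * ψ * Q')))) ^ p) :=
          mul_le_mul_of_nonneg_left hbr (by positivity)
      _ = (Aro + A' * (4 * σ * lam * Q' / (1 - 4 * σ * lam * Q')) + exp 1 * ψ * (τ * Yl) * (Φ * (τ * Yl) / (1 - Φ * (τ * Yl)))) *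
            lam ^ (p - 1) * (max 1 (max (C₂ ^ 2 * ((2 : ℝ) ^ (d - 1))⁻¹ * max Q Qb) (max (4 * Q') (2 * τ * ψ * Q')))) ^ p := by ring
  have hAtot0 : 0 ≤ Atot := by rw [hAtot]; positivity
  have hQtot0 : 0 ≤ Qtot := by rw [hQtot]; exact zero_le_one.trans (le_max_left _ _)
  exact readoutLev_le_levelsRHS hβ hKl U hAtot0 hQtot0 hB hCE t (by omega) j hfin

/-! ## The same at any read-out level `dk ≤ j` (first levels of block 1) -/

omit [NeZero L] [NeZero M] in
/-- **THE READ-OUT AT ANY LEVEL `dk ≤ j` IS BELOW `KernelNormsLevels`' RIGHT-HAND SIDE, FROM NAMED INPUTS** — twin of `readoutLevF_le_levelsRHS_of_rows` without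
`2d − 2 ≤ j` (the first levels of block 1), the re-measured part read through `readoutLevF_le_profileR_anyJump`
(`A_ro = 27⁵(C₁/C₂)(A_b + 8^{d−1}A/(1−(2^d)⁻¹))`, `Q_ro = C₂²·max Q_b ((2^{d−1})⁻¹·max Q Q_b)`). [cite: BenfattoGiulianiMastropietro2006, §2.8 (2.83), (2.93)-(2.98), Lemma 2.5 (2.98)] -/
theorem readoutLevF_le_levelsRHS_of_rows_anyJump :
    ∃ C₁ C₂ : ℝ, 0 < C₁ ∧ 0 < C₂ ∧ ∀ R : RenConsts, R.WF2 → ∃ c₃' : ℝ, 0 < c₃' ∧ ∃ U₀' : ℝ, 0 < U₀' ∧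
      ∀ (P : SplitConsts) (c : ℝ), P.WF → 0 < c → c ≤ klEngC₃6 P R → c ≤ c₃' →
      ∀ μ ∈ klWindowC, ∀ U : ℝ, 0 < U → U ≤ klEngU₀9 P R c → U ≤ U₀' → ∀ β : ℝ, klBetaMin ≤ β → β ≤ Real.exp (c / U ^ 2) →
      ∀ K : TrigPolyC4v, FrameOK R U (nScales β) μ K → ∀ (L M : ℕ) [NeZero L] [NeZero M],
      klEngL₃ β U ≤ L → klEngM₃ β U L ≤ M → ∀ d k j D : ℕ, 2 ≤ d → 1 ≤ k → d * k ≤ j → j ≤ nScales β + 1 → 3 ≤ D →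
      ∀ (A B Q Ab Qb : ℝ), 0 ≤ A → 1 ≤ B → 0 ≤ Q → 0 ≤ Ab → 0 ≤ Qb →
      -- the base datum at `F_{d−1}` and its unit law, at `λ = B·ε_j`
      ∀ Nb : Fin 5 → ℕ → ℝ, (∀ t p, 0 ≤ Nb t p) →
        (∀ (t : Fin 5) (p : ℕ) (Ωe' : Fin (2 * p) → Option (SectorLeg (sectorCount (d - 1)))), levelCount Ωe' = (t : ℕ) + 1 →
          klLevNormOf L M β μ K (d - 1) (2 * p) (klTowerInput L M β U μ K d 1) Ωe' ≤ Nb t p) →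
        (∀ (t : Fin 5) (p : ℕ), 3 ≤ p → Nb t p / klLevUnitF β M t p (d - 1) ≤ Ab * (B * epsCoupling P U j) ^ (p - 1) * Qb ^ p) →
      -- the law on the blocks `2 ≤ k′ ≤ k`
      (∀ k' : ℕ, 2 ≤ k' → k' ≤ k → ∀ (t : Fin 5) (p : ℕ), 3 ≤ p → p ≤ D →
        klTowerBLevF L M β U μ K d t k' p ≤ A * (B * epsCoupling P U j) ^ (p - 1) * Q ^ p) →
      ∀ (W Z σ Φ ψ τ A' Q' ι₁ ι₂ ι₃ : ℝ), 0 < W → 0 < Z → 0 ≤ σ → 0 ≤ Φ → 0 ≤ ψ → 0 < τ → 0 ≤ A' → 0 < Q' →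
      -- the Chernoff data of block `k` (exported by the law) and the imports at block `k`
      (∀ m, 4 ≤ m → m ≤ D → W * Z ^ m * klTowerMuLevF L M β U μ K d k m ≤ A' * (B * epsCoupling P U j) ^ (m - 1) * Q' ^ m) →
      W * Z ^ 3 * klTowerMuLevF L M β U μ K d k 3 ≤ ι₃ * (B * epsCoupling P U j) ^ 2 →
      W * Z ^ 1 * klTowerMuLevF L M β U μ K d k 1 ≤ ι₁ * (B * epsCoupling P U j) →
      W * Z ^ 2 * klTowerMuLevF L M β U μ K d k 2 ≤ ι₂ * (B * epsCoupling P U j) →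
      -- the five smallness rows at `(A′, Q′, λ)` (exported by the law)
      4 * σ * (B * epsCoupling P U j) * Q' < 1 → 2 * (B * epsCoupling P U j) * τ * Q' ≤ 1 → exp 1 * τ * (B * epsCoupling P U j) * Q' < 1 →
      Φ * (τ * (ι₁ * (B * epsCoupling P U j) + ι₂ / (2 * Q') + ι₃ / (4 * Q' ^ 2) + A' * Q' / 4)) < 1 →
      Φ * (exp 1 * τ * (ι₁ * (B * epsCoupling P U j)) + (exp 1 * τ) ^ 2 * (ι₂ * (B * epsCoupling P U j)) +
          (exp 1 * τ) ^ 3 * (ι₃ * (B * epsCoupling P U j) ^ 2) +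
        A' * (exp 1 * τ * Q') * ((exp 1 * τ * (B * epsCoupling P U j) * Q') ^ 3 / (1 - exp 1 * τ * (B * epsCoupling P U j) * Q'))) < 1 →
      -- the partial-block step at `(k, j)`, every track (k3c2-p3's RO-2)
      (∀ t : Fin 5, ∀ N : ℕ, 2 ≤ N → ∀ p, 3 ≤ p → p ≤ D →
        Φ * towerV D τ (fun m => W * Z ^ m * klTowerMuLevF L M β U μ K d k m) < 1 →
        ∀ Ωe : Fin (2 * p) → Option (SectorLeg (sectorCount j)), levelCount Ωe = (t : ℕ) + 1 →
        klLevNormOf L M β μ K j (2 * p) (klEffectiveAction L M β U μ K klE0 j - klTowerInput L M β U μ K d k) Ωe / klLevUnitF β M t p j ≤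
          towerFO D σ (fun m => W * Z ^ m * klTowerMuLevF L M β U μ K d k m) p +
            ∑ n ∈ Icc 2 N, exp 1 * Φ ^ (n - 1) * ψ ^ p * towerS D τ (fun m => W * Z ^ m * klTowerMuLevF L M β U μ K d k m) n p +
            ψ ^ p * exp 1 * towerV D τ (fun m => W * Z ^ m * klTowerMuLevF L M β U μ K d k m) *
              (Φ * towerV D τ (fun m => W * Z ^ m * klTowerMuLevF L M β U μ K d k m)) ^ N /
              (1 - Φ * towerV D τ (fun m => W * Z ^ m * klTowerMuLevF L M β U μ K d k m))) →
      -- the read-out constants (equational binders) and the threshold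
      ∀ (Aro Qro Qtot Atot : ℝ), Aro = (27 : ℝ) ^ 5 * (C₁ / C₂) * (Ab + (8 : ℝ) ^ (d - 1) * (A / (1 - ((2 : ℝ) ^ d)⁻¹))) →
        Qro = C₂ ^ 2 * max Qb (((2 : ℝ) ^ (d - 1))⁻¹ * max Q Qb) → Qtot = max 1 (max Qro (max (4 * Q') (2 * τ * ψ * Q'))) →
        Atot = Aro + A' * (4 * σ * (B * epsCoupling P U j) * Q' / (1 - 4 * σ * (B * epsCoupling P U j) * Q')) +
          exp 1 * ψ * (τ * (ι₁ * (B * epsCoupling P U j) + ι₂ / (2 * Q') + ι₃ / (4 * Q' ^ 2) + A' * Q' / 4)) *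
            (Φ * (τ * (ι₁ * (B * epsCoupling P U j) + ι₂ / (2 * Q') + ι₃ / (4 * Q' ^ 2) + A' * Q' / 4)) /
              (1 - Φ * (τ * (ι₁ * (B * epsCoupling P U j) + ι₂ / (2 * Q') + ι₃ / (4 * Q' ^ 2) + A' * Q' / 4)))) →
      ∀ CE : ℝ, Qtot * imagTimeWeight β M ^ 2 * B * max 1 (Atot / imagTimeWeight β M) ≤ CE →
      ∀ (t : Fin 5) (p : ℕ), 3 ≤ p → p ≤ D → 7 ≤ 2 * p + (t : ℕ) →
      ∀ Ωe : Fin (2 * p) → Option (SectorLeg (sectorCount j)), levelCount Ωe = (t : ℕ) + 1 →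
        klLevNormOf L M β μ K j (2 * p) (klEffectiveAction L M β U μ K klE0 j) Ωe ≤
          CE ^ p * epsCoupling P U j ^ (p - 1) * (2 : ℝ) ^ ((3 * (p : ℤ) - 5) * j) * (((2 : ℝ) ^ j)⁻¹) ^ levelGainExp ((t : ℕ) + 1) := by
  obtain ⟨C₁, C₂, hC₁, hC₂, h⟩ := readoutLevF_le_profileR_anyJump
  refine ⟨C₁, C₂, hC₁, hC₂, fun R hR2 => ?_⟩
  obtain ⟨c₃, hc₃, U₀, hU₀, h'⟩ := h R hR2
  refine ⟨c₃, hc₃, U₀, hU₀, ?_⟩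
  intro P c hP hc hc6 hc₃' μ hμ U hU hU9 hU₀' β hβmin hβc K hK L M _ _ hL3 hM3 d k j D hd hk1 hkj hjN hD A B Q Ab Qb hA hB hQ hAb hQb Nb hNb0 hcar
    hlawb hIH W Z σ Φ ψ τ A' Q' ι₁ ι₂ ι₃ hW hZ hσ hΦ hψ hτ hA'0 hQ'0 hprof hprof3 himp₁ himp₂ hx₁ hx₂ hx₃ hy hθ hinc Aro Qro Qtot Atot hAro hQro hQtot
    hAtot CE hCE t p hp hpD hpt Ωe hlev
  have hβ : 0 < β := KLRegimeSplit.pos_of_klBetaMin_le hβmin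
  have hK1 : 1 ≤ P.Klam := hP.1
  have hKl : 0 ≤ P.Klam := le_trans zero_le_one hK1
  have hε : 0 < epsCoupling P U j := by
    unfold epsCoupling
    have : 0 < |U| + U ^ 2 * (j : ℝ) := by positivity
    positivity
  have hB0 : 0 < B := lt_of_lt_of_le one_pos hB
  set lam : ℝ := B * epsCoupling P U j with hlamdef
  have hlam : 0 < lam := mul_pos hB0 hε
  have hu : 0 < klLevUnitF β M t p j := klLevUnitF_pos hβ t p j
  have hμ0 : ∀ m, 0 ≤ (fun m => W * Z ^ m * klTowerMuLevF L M β U μ K d k m) m := fun m =>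
    mul_nonneg (by positivity) (klTowerMuLevF_nonneg (L := L) (M := M) hβ U μ K d k m)
  -- the nonnegativity of the imports from the rows
  have hι₁0 : 0 ≤ ι₁ := by
    have h1 : 0 ≤ ι₁ * lam := (hμ0 1).trans himp₁
    rw [mul_comm] at h1
    exact nonneg_of_mul_nonneg_right h1 hlam
  have hι₂0 : 0 ≤ ι₂ := by
    have h1 : 0 ≤ ι₂ * lam := (hμ0 2).trans himp₂
    rw [mul_comm] at h1
    exact nonneg_of_mul_nonneg_right h1 hlam
  have hι₃0 : 0 ≤ ι₃ := by
    have h1 : 0 ≤ ι₃ * lam ^ 2 := (hμ0 3).trans hprof3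
    rw [mul_comm] at h1
    exact nonneg_of_mul_nonneg_right h1 (by positivity)
  -- (1) the re-measured part (RO-1), with the weight `27^{t+1} ≥ 1` dropped
  have hX₀0 : 0 ≤ klLevNormOf L M β μ K j (2 * p) (klTowerInput L M β U μ K d k) Ωe := klLevNormOf_nonneg hβ.le μ K j (2 * p) _ Ωe
  have hro27 := h' P c hP hc hc6 hc₃' μ hμ U hU hU9 hU₀' β hβmin hβc K hK L M hL3 hM3 d k j hd hk1 hkj hjN D A lam Q Ab Qb hA hlam.le hQ hAb hQb
    Nb hNb0 hcar hlawb hIH t p hp hpD hpt Ωe hlev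
  have hAro0 : 0 ≤ Aro := by
    have hρ1 : ((2 : ℝ) ^ d)⁻¹ < 1 := inv_lt_one_of_one_lt₀ (one_lt_pow₀ (by norm_num) (by omega))
    have : 0 ≤ A / (1 - ((2 : ℝ) ^ d)⁻¹) := div_nonneg hA (sub_nonneg.2 hρ1.le)
    rw [hAro]; positivity
  have hQro0 : 0 ≤ Qro := by
    have : 0 ≤ max Qb (((2 : ℝ) ^ (d - 1))⁻¹ * max Q Qb) := le_max_of_le_left hQb
    rw [hQro]; positivity
  have hro : klLevNormOf L M β μ K j (2 * p) (klTowerInput L M β U μ K d k) Ωe / klLevUnitF β M t p j ≤ Aro * lam ^ (p - 1) * Qro ^ p := by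
    have h27 : (1 : ℝ) ≤ (27 : ℝ) ^ ((t : ℕ) + 1) := one_le_pow₀ (by norm_num)
    have hq0 : 0 ≤ klLevNormOf L M β μ K j (2 * p) (klTowerInput L M β U μ K d k) Ωe / klLevUnitF β M t p j := div_nonneg hX₀0 hu.le
    calc klLevNormOf L M β μ K j (2 * p) (klTowerInput L M β U μ K d k) Ωe / klLevUnitF β M t p j
        ≤ (27 : ℝ) ^ ((t : ℕ) + 1) * klLevNormOf L M β μ K j (2 * p) (klTowerInput L M β U μ K d k) Ωe / klLevUnitF β M t p j := by
          rw [mul_div_assoc]; exact le_mul_of_one_le_left hq0 h27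
      _ ≤ _ := by rw [hAro, hQro]; exact hro27
  -- (2) `𝒱_j = 𝒱_{dk} + (𝒱_j − 𝒱_{dk})`: the public size is at most `ro + inc`
  have hpub : klLevNormOf L M β μ K j (2 * p) (klEffectiveAction L M β U μ K klE0 j) Ωe / klLevUnitF β M t p j ≤
      klLevNormOf L M β μ K j (2 * p) (klTowerInput L M β U μ K d k) Ωe / klLevUnitF β M t p j +
        klLevNormOf L M β μ K j (2 * p) (klEffectiveAction L M β U μ K klE0 j - klTowerInput L M β U μ K d k) Ωe / klLevUnitF β M t p j := by
    rw [← add_div]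
    refine div_le_div_of_nonneg_right ?_ hu.le
    have h := klLevNormOf_add_le hβ.le μ K j (2 * p) (klTowerInput L M β U μ K d k)
      (klEffectiveAction L M β U μ K klE0 j - klTowerInput L M β U μ K d k) Ωe
    rwa [add_sub_cancel] at h
  -- (3) E1 part 7 with the re-measured part under its own profile
  have hfit := towerReadout_le_of_ro (D := D) (μ := fun m => W * Z ^ m * klTowerMuLevF L M β U μ K d k m) hσ hΦ hψ hτ hlam hA'0 hQ'0 hμ0
    himp₁ himp₂ hprof3 hprof hx₁ hx₂ hx₃ hy hθ hp hpub hro (fun N hN hg => hinc t N hN p hp hpD hg Ωe hlev)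
  -- (4) the bracket under one law, and the levels right-hand side
  set Yl : ℝ := ι₁ * lam + ι₂ / (2 * Q') + ι₃ / (4 * Q' ^ 2) + A' * Q' / 4 with hYl
  have hYl0 : 0 ≤ Yl := by positivity
  have hTY : 0 ≤ τ * Yl := by positivity
  have hx10 : 0 ≤ 4 * σ * lam * Q' / (1 - 4 * σ * lam * Q') := div_nonneg (by positivity) (sub_nonneg.2 hx₁.le)
  have hYy : 0 ≤ Φ * (τ * Yl) / (1 - Φ * (τ * Yl)) := div_nonneg (by positivity) (sub_nonneg.2 hy.le)
  have hbr := readoutBracket_le_law hAro0 hQro0 hA'0 hQ'0.le hψ hτ.le hx10 hTY hYy p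
  have hfin : klLevNormOf L M β μ K j (2 * p) (klEffectiveAction L M β U μ K klE0 j) Ωe / klLevUnitF β M t p j ≤
      Atot * (B * epsCoupling P U j) ^ (p - 1) * Qtot ^ p := by
    refine hfit.trans ?_
    rw [hAtot, hQtot, hQro]
    rw [hQro] at hbr
    calc lam ^ (p - 1) * (Aro * (C₂ ^ 2 * max Qb (((2 : ℝ) ^ (d - 1))⁻¹ * max Q Qb)) ^ p +
            A' * (4 * Q') ^ p * (4 * σ * lam * Q' / (1 - 4 * σ * lam * Q')) +
            exp 1 * ψ * (2 * τ * ψ * Q') ^ (p - 1) * (τ * Yl) * (Φ * (τ * Yl) / (1 - Φ * (τ * Yl))))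
        ≤ lam ^ (p - 1) * ((Aro + A' * (4 * σ * lam * Q' / (1 - 4 * σ * lam * Q')) + exp 1 * ψ * (τ * Yl) * (Φ * (τ * Yl) / (1 - Φ * (τ * Yl)))) *
            (max 1 (max (C₂ ^ 2 * max Qb (((2 : ℝ) ^ (d - 1))⁻¹ * max Q Qb)) (max (4 * Q') (2 * τ * ψ * Q')))) ^ p) :=
          mul_le_mul_of_nonneg_left hbr (by positivity)
      _ = (Aro + A' * (4 * σ * lam * Q' / (1 - 4 * σ * lam * Q')) + exp 1 * ψ * (τ * Yl) * (Φ * (τ * Yl) / (1 - Φ * (τ * Yl)))) *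
            lam ^ (p - 1) * (max 1 (max (C₂ ^ 2 * max Qb (((2 : ℝ) ^ (d - 1))⁻¹ * max Q Qb)) (max (4 * Q') (2 * τ * ψ * Q')))) ^ p := by ring
  have hAtot0 : 0 ≤ Atot := by rw [hAtot]; positivity
  have hQtot0 : 0 ≤ Qtot := by rw [hQtot]; exact zero_le_one.trans (le_max_left _ _)
  exact readoutLev_le_levelsRHS hβ hKl U hAtot0 hQtot0 hB hCE t (by omega) j hfin

end Summit.HubbardSuperconductivity.HubbardSuperconductivity.Theorems.EngineV8

end
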